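/-
Origin: expansion seat `planner-pub-hodgecm-mc-axioms-1-g14-0`, handover #W33 2026-08-20T15:53:55Z md5 002f6e63803d (PKG 8571cf1707a3 → 002f6e63803d; 194 l.; MECHANICAL (iib-R) rewrite v3.1 of the PKG file as it stands (56 token edits; rules R1x1+R2x5+RX[h₂']x4+R3x1+R8x45)) (`HOME/mc/pub-hodgecm-mc-axioms-1-g14/revendor/kit-r55/stage55/HodgeCM/Model/CoverInstance.lean`, md5 002f6e63803d, 194 lines);
landed by the gen-22 packager (p-g22) in gate run 55 REPLACES the earlier landed copy of `HodgeCM/Model/CoverInstance.lean` (seat copy carried the packager Origin header of an earlier run (stripped)).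
-/
/-
Unit pub-hodgecm-mc-glue-1-g2 (node E, vacancy (ii-cov) KERNEL half). NEW additive leaf `HodgeCM/Model/CoverInstance.lean`.
The `cover` DATA field of the adelic theta core for the model universe, CONSTRUCTED: the level covering
`X_{Γ'} ⟶ X_Γ` (`Γ' ≤ Γ`) as a morphism of the CHOSEN algebraic models, from the record
`Arapura2012_Cor_15_4_6` (N-G0-cov, the only hypothesis) and the kernel theorem
`LevelCovering.exists_hom_map_unif_eq` (`HodgeCM/Model/LevelCovering.lean`, package-native, KERNEL), together with its junction
equation over the uniformisations. Expected `#print axioms`: {propext, Classical.choice, Quot.sound}.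
-/
import Summits.HodgeConjecture.HodgeCM.Model.Universe
import Summits.HodgeConjecture.HodgeCM.Model.LevelCovering

/-!
# The level covering `cover` of the model universe (vacancy (ii-cov), kernel half)

For the Picard–CM model universe `U := picardCMUniverse hHD hI h₁ hU h₃` and two levels `Γ' ≤ Γ` of one
hermitian space `V`, the field `cover Γ Γ' : U.Mor (U.pms L ι₁ V Γ') (U.pms L ι₁ V Γ)` of the adelic theta
core is here a TERM, `Model.coverOf … hA Γ Γ' h`, over the single record
`hA : Arapura2012_Cor_15_4_6` ("a holomorphic map between nonsingular projective algebraic varieties is a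
morphism of varieties"):

* in the anisotropic regime (`IsAnisotropic L V.Hm`; always when `2 < [L:ℚ]`, `isAnisotropic_of_two_lt`)
  the two schemes carry the ball-quotient data `ballDatumOf … Γ' _`, `ballDatumOf … Γ _` of ONE complex
  hermitian space with nested groups (`ballDatumOf_Hℂ_eq`, `ballDatumOf_map_Γ_le`, from the realisation's
  clauses `datum_H`, `datum_Γ`), and `coverOf` is a CHOICE of the morphism provided by
  `LevelCovering.exists_hom_map_unif_eq` (the level covering of the analytifications is
  holomorphic — kernel — hence algebraic — the record); its defining property is the junction
  `map_coverOf_unif : (coverOf …)(ℂ) (unif_{Γ'} v) = unif_Γ v` on the cone;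
* off that regime (never met on the `PerL` path, J-SAN″) both schemes are the total branch `ℙ²` of
  `pmsRealisation` and `coverOf` is the identity `eqToHom`.

No property of `cover` other than `map_coverOf_unif` is asserted here; the pull-back facts the C4 / C5′ /
C6′ producers use are theirs to derive from it.
-/

noncomputable section

open scoped Matrix ComplexOrder
open NumberField CategoryTheory
open Literature.AlgebraicGeometry.Motives
open Literature.AlgebraicGeometry.ShimuraVarieties
open Literature.NumberTheory.Transcendental (Arapura2012_Cor_15_4_6)

namespace HodgeCM

namespace Model

open Literature.NumberTheory.Automorphic.PicardCM
open Literature.AlgebraicGeometry.HodgeTheory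

section Codes

variable {L : CMField} {ι₁ : L →+* ℂ} {V : HermSpace3 L ι₁}

/-- The codes of two levels of one hermitian space have the same field (by construction of
`pmsCode` / `PicardCode.ofHermitian`). -/
theorem pmsCode_E (Γ Γ' : Level V) : (pmsCode L ι₁ V Γ').E = (pmsCode L ι₁ V Γ).E := rfl

/-- … and the same Gram matrix. -/
theorem pmsCode_H (Γ Γ' : Level V) : (pmsCode L ι₁ V Γ').H = (pmsCode L ι₁ V Γ).H := rfl

/-- … and nested groups when `Γ' ≤ Γ`. -/
theorem pmsCode_Γ_le {Γ Γ' : Level V} (hle : Γ'.Γ ≤ Γ.Γ) :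
    (pmsCode L ι₁ V Γ').Γ ≤ (pmsCode L ι₁ V Γ).Γ :=
  Subgroup.map_mono hle

/-- Anisotropy of the code does not depend on the level. -/
theorem isAnisotropic_pmsCode_of (Γ Γ' : Level V) (h : IsAnisotropic L V.Hm) :
    (pmsCode L ι₁ V Γ').IsAnisotropic ∧ (pmsCode L ι₁ V Γ).IsAnisotropic :=
  ⟨(isAnisotropic_pmsCode_iff L ι₁ V Γ').2 h, (isAnisotropic_pmsCode_iff L ι₁ V Γ).2 h⟩

end Codes

section Data

variable (hU : BallQuotientUniformisedDatum) (h₃ : CMAbelianVarietyRealised)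
variable {L : CMField} {ι₁ : L →+* ℂ} {V : HermSpace3 L ι₁}

/-- The two ball data of nested levels have THE SAME complex Gram matrix (clause `datum_H` of the
realisation, twice). -/
theorem ballDatum_Hℂ_eq (Γ Γ' : Level V) (h' : (pmsCode L ι₁ V Γ').IsAnisotropic)
    (h : (pmsCode L ι₁ V Γ).IsAnisotropic) :
    (Var.ballDatum hU h₃ (pmsCode L ι₁ V Γ') h').Hℂ = (Var.ballDatum hU h₃ (pmsCode L ι₁ V Γ) h).Hℂ := by
  change ((pmsRealisation hU _).datum h').H.map ((pmsRealisation hU _).datum h').E.subtype =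
    ((pmsRealisation hU _).datum h).H.map ((pmsRealisation hU _).datum h).E.subtype
  rw [(pmsRealisation hU (pmsCode L ι₁ V Γ')).datum_H h', (pmsRealisation hU (pmsCode L ι₁ V Γ)).datum_H h]
  rfl

/-- … and NESTED groups read in `GL₃(ℂ)` (clause `datum_Γ`, twice, and `Γ' ≤ Γ`). -/
theorem ballDatum_map_Γ_le {Γ Γ' : Level V} (hle : Γ'.Γ ≤ Γ.Γ)
    (h' : (pmsCode L ι₁ V Γ').IsAnisotropic) (h : (pmsCode L ι₁ V Γ).IsAnisotropic) :
    (Var.ballDatum hU h₃ (pmsCode L ι₁ V Γ') h').Γ.map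
        (Matrix.GeneralLinearGroup.map (Var.ballDatum hU h₃ (pmsCode L ι₁ V Γ') h').τ₁) ≤
      (Var.ballDatum hU h₃ (pmsCode L ι₁ V Γ) h).Γ.map
        (Matrix.GeneralLinearGroup.map (Var.ballDatum hU h₃ (pmsCode L ι₁ V Γ) h).τ₁) := by
  change ((pmsRealisation hU _).datum h').Γ.map
      (Matrix.GeneralLinearGroup.map ((pmsRealisation hU _).datum h').E.subtype) ≤
    ((pmsRealisation hU _).datum h).Γ.map
      (Matrix.GeneralLinearGroup.map ((pmsRealisation hU _).datum h).E.subtype)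
  rw [(pmsRealisation hU (pmsCode L ι₁ V Γ')).datum_Γ h', (pmsRealisation hU (pmsCode L ι₁ V Γ)).datum_Γ h]
  exact Subgroup.map_mono (pmsCode_Γ_le hle)

/-- Off the anisotropic regime the realising scheme is the total branch `ℙ²`. -/
theorem scheme_pms_of_not_isAnisotropic (c : PicardCode) (hc : ¬ c.IsAnisotropic) :
    Var.scheme hU h₃ (.pms c) = projectiveSpace 2 ℂ := by
  rw [Var.scheme_pms, pmsRealisation, dif_neg hc]

/-- **The level covering is a morphism of the models** (anisotropic regime): from the kernel theorem
`LevelCovering.exists_hom_map_unif_eq` on the two ball data (same `Hℂ`, nested groups) read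
in the chosen real Hodge models, under the record `hA`. -/
theorem exists_levelCover (hHD : exists_isReal_hodgeModel) (hA : Arapura2012_Cor_15_4_6) {Γ Γ' : Level V}
    (hle : Γ'.Γ ≤ Γ.Γ)
    (h' : (pmsCode L ι₁ V Γ').IsAnisotropic) (h : (pmsCode L ι₁ V Γ).IsAnisotropic) :
    ∃ g : Var.scheme hU h₃ (.pms (pmsCode L ι₁ V Γ')) ⟶ Var.scheme hU h₃ (.pms (pmsCode L ι₁ V Γ)),
      ∀ v ∈ (Var.ballDatum hU h₃ (pmsCode L ι₁ V Γ') h').cone,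
        AlgPoints.map g ((Var.ballDatum hU h₃ (pmsCode L ι₁ V Γ') h').unif v) =
          (Var.ballDatum hU h₃ (pmsCode L ι₁ V Γ) h).unif v :=
  LevelCovering.exists_hom_map_unif_eq hA (ballDatum_Hℂ_eq hU h₃ Γ Γ' h' h)
    (ballDatum_map_Γ_le hU h₃ hle h' h)
    (BettiUniverse.realHodgeModel hHD (Var.isSmoothProjective hU h₃ (.pms (pmsCode L ι₁ V Γ'))))
    (BettiUniverse.realHodgeModel hHD (Var.isSmoothProjective hU h₃ (.pms (pmsCode L ι₁ V Γ))))

open scoped Classical in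
/-- **The level covering `X_{Γ'} ⟶ X_Γ` of the model universe over (ii) `hU`** (`Γ' ≤ Γ`): the chosen
morphism of `exists_levelCover` in the anisotropic regime, the identity of `ℙ²` off it. -/
def levelCover (hHD : exists_isReal_hodgeModel) (hA : Arapura2012_Cor_15_4_6) (Γ Γ' : Level V)
    (hle : Γ'.Γ ≤ Γ.Γ) :
    Var.Mor hU h₃ (.pms (pmsCode L ι₁ V Γ')) (.pms (pmsCode L ι₁ V Γ)) :=
  if h : IsAnisotropic L V.Hm then
    (exists_levelCover hU h₃ hHD hA hle (isAnisotropic_pmsCode_of Γ Γ' h).1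
      (isAnisotropic_pmsCode_of Γ Γ' h).2).choose
  else
    eqToHom (by
      rw [scheme_pms_of_not_isAnisotropic hU h₃ _
            (fun h' ↦ h ((isAnisotropic_pmsCode_iff L ι₁ V Γ').1 h')),
          scheme_pms_of_not_isAnisotropic hU h₃ _
            (fun h' ↦ h ((isAnisotropic_pmsCode_iff L ι₁ V Γ).1 h'))])

/-- **Junction**: in the anisotropic regime the level covering lies over the uniformisations,
`levelCover(ℂ) (unif_{Γ'} v) = unif_Γ v` on the cone. -/
theorem map_levelCover_unif (hHD : exists_isReal_hodgeModel) (hA : Arapura2012_Cor_15_4_6) {Γ Γ' : Level V}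
    (hle : Γ'.Γ ≤ Γ.Γ)
    (h : IsAnisotropic L V.Hm) {v : Fin 3 → ℂ}
    (hv : v ∈ (Var.ballDatum hU h₃ (pmsCode L ι₁ V Γ') ((isAnisotropic_pmsCode_iff L ι₁ V Γ').2 h)).cone) :
    AlgPoints.map (levelCover hU h₃ hHD hA Γ Γ' hle)
        ((Var.ballDatum hU h₃ (pmsCode L ι₁ V Γ') ((isAnisotropic_pmsCode_iff L ι₁ V Γ').2 h)).unif v) =
      (Var.ballDatum hU h₃ (pmsCode L ι₁ V Γ) ((isAnisotropic_pmsCode_iff L ι₁ V Γ).2 h)).unif v := by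
  unfold levelCover
  rw [dif_pos h]
  exact (exists_levelCover hU h₃ hHD hA hle (isAnisotropic_pmsCode_of Γ Γ' h).1
    (isAnisotropic_pmsCode_of Γ Γ' h).2).choose_spec v hv

end Data

/-! ### On the end-state universe `picardCMUniverse` -/

section EndState

variable (hHD : exists_isReal_hodgeModel) (hI : hodgePQ_independent_of_hodgeModel)
  (h₁ : BallQuotientUniformised)  (h₃ : CMAbelianVarietyRealised)

/-- **`cover` for the model universe** — the binder of `Model.perL_picardCM_r2` of that name, as a term
over the record `hA : Arapura2012_Cor_15_4_6`:
`coverOf … hA Γ Γ' h : U.Mor (U.pms L ι₁ V Γ') (U.pms L ι₁ V Γ)` for `U = picardCMUniverse hHD hI h₁ hU h₃`. -/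
def coverOf (hA : Arapura2012_Cor_15_4_6) {L : CMField} {ι₁ : L →+* ℂ} {V : HermSpace3 L ι₁}
    (Γ Γ' : Level V) (hle : Γ'.Γ ≤ Γ.Γ) :
    (picardCMUniverse hHD hI h₁ h₃).Mor ((picardCMUniverse hHD hI h₁ h₃).pms L ι₁ V Γ')
      ((picardCMUniverse hHD hI h₁ h₃).pms L ι₁ V Γ) :=
  levelCover (ballQuotientUniformisedDatum_of h₁) h₃ hHD hA Γ Γ' hle

/-- **Junction for `cover`** on the end-state universe: `(coverOf … Γ Γ' h)(ℂ) ∘ unif_{Γ'} = unif_Γ` on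
the cone of the ball data `ballDatumOf` (anisotropic regime). -/
theorem map_coverOf_unif (hA : Arapura2012_Cor_15_4_6) {L : CMField} {ι₁ : L →+* ℂ}
    {V : HermSpace3 L ι₁} {Γ Γ' : Level V} (hle : Γ'.Γ ≤ Γ.Γ) (h : IsAnisotropic L V.Hm)
    {v : Fin 3 → ℂ}
    (hv : v ∈ (ballDatumOf (hHD := hHD) (hI := hI) (hU := ballQuotientUniformisedDatum_of h₁) (h₃ := h₃)
      L ι₁ V Γ' h).cone) :
    AlgPoints.map (coverOf hHD hI h₁ h₃ hA Γ Γ' hle)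
        ((ballDatumOf (hHD := hHD) (hI := hI) (hU := ballQuotientUniformisedDatum_of h₁) (h₃ := h₃)
          L ι₁ V Γ' h).unif v) =
      (ballDatumOf (hHD := hHD) (hI := hI) (hU := ballQuotientUniformisedDatum_of h₁) (h₃ := h₃)
        L ι₁ V Γ h).unif v :=
  map_levelCover_unif (ballQuotientUniformisedDatum_of h₁) h₃ hHD hA hle h hv

end EndState

end Model

end HodgeCM

end
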